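import Summits.QuantumFields.YangMills.Theorems.UnitScaleTiltProp7HermiteCornerBlendTorus
import Summits.QuantumFields.YangMills.Theorems.UnitScaleTiltProp7ConjFrameTransition
import Summits.QuantumFields.YangMills.Theorems.UnitScaleTiltProp7HermiteLineCovariant
import HarnessLib

/-!
# Route `UnitScaleTilt`, crux K1 «MinimiserStabilityRegPr» (stmt-QuantumFields-19200), route-R E′ path (α′), row LEMMA-H-CURVED — FILE 6 (the data row):
# THE RECENTRED DATA ROW OF THE CORNER BLEND FROM A PAIR ROW AT THE CENTRES AND THE FRAME SIZE ROW ALONG AN IN-BLOCK PATH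

Cell `ym3-torus`, D-0154 (3c) twin-width seat `ym-routeR-w1` (gen 5); row "routeR-w1 g5: LEMMA-H-CURVED" (namer ★ym-ust-19200-p1 g14, 2026-08-28 17:33Z; design of record
(x2′-corner), contract v2 18:49Z).  THEOREMS ONLY (0 `def`, 0 `sorry`); `--supports stmt-QuantumFields-19200`, count-neutral.  YM₃ on T³ is a ladder rung (R3), not the
Clay problem; nothing here claims a stub, the crux, d = 4 or the mass gap.

WHAT.  ✓ `Prop7HermiteCornerBlendTorus.exists_extension_lap_energy_le` ∕ ✓ `Prop7LemmaHCurvedOfRows.lemmaH_curved_of_rows` display a DATA ROW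
`‖R(Fr_y z) m_y − Z_μ(z)‖ ≤ G_y` on the support predicate `∀ ν, y_ν − Q_ν(z) ∈ {−1,0,1,2}` for an arbitrary recentring `Z`.  This file supplies it for the recentring at
the LOWER-CORNER FRAME, `Z(z) := R(Fr_(Q z) z) m_(Q z)`: ★★★ `dataRow_lowerCorner`:
  `‖R(Fr_y z) m_y − R(Fr_(Q z) z) m_(Q z)‖ ≤ D_y + 2·(d·ℓ·(a₀ + a₀))·‖m_y − c_y‖`
given (i) bi-contractive frames normalised at their centres with the SIZE row `‖h_(y,μ)(w) − 1‖ ≤ a₀` at every `w` of the support predicate, (ii) central `c_y`, (iii) the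
displayed PAIR ROW at the centres `‖R(Fr_y(embIter y₀)) m_y − m_(y₀)‖ ≤ D_y` for `y − y₀ ∈ {−1,0,1,2}^d` (frame-`y` transport of `m_y` to the neighbouring centre against
`m_(y₀)`: the consumer's coarse covariant differences plus the (3.35) contour-versus-straight holonomy — gauge-specific, hence displayed).

HOW.  Sect. 1 (abstract carrier): `norm_transition_iterate_sub_le` — the transition function `g = Fr_(y₀)⁻¹Fr_y` moves by the two holonomy defects along a run, LOCALISED rows
(cf. ✓ `Prop7ConjFrameTransition.norm_transition_foldl_sub_le`, which wants them globally); `dataRow_of_pair` — `‖R(Fr_y z)m − R(Fr_(y₀) z)m₀‖ ≤ ‖R(Fr_y c₀)m − m₀‖ +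
2‖g(z) − g(c₀)‖·‖m − c‖` when `Fr_(y₀)(c₀) = 1` (✓ `R_frame_transition`, ✓ `norm_frame_mismatch_le`).  Sect. 2 (fine torus, offset `h = (ℓ−1)∕2`) the in-block coordinate path
`embIter(Q z) → z` (`blockLabel_eq_of_coord`, `self_eq_centre_add_offset`, `path_succ`, `norm_transition_path_sub_le`: `‖g(z) − g(embIter(Q z))‖ ≤ d·ℓ·(a₀ + a₀)`).  Sect. 3: the row.
HONEST SCOPE.  Bookkeeping; the pair row and the frame rows are hypotheses; nothing of Bałaban's is asserted.

References: T. Bałaban, CMP 99 (1985) 389–434 [Balaban1985BackgroundPropagators] ((3.3) p.390, (3.35) p.396); CMP 95 (1984) 17–40 [Balaban1984PropagatorsI] ((1.18) p.20).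
-/

set_option autoImplicit false

noncomputable section

open scoped BigOperators

namespace Summit.QuantumFields.YangMills.Theorems.Prop7HermiteCornerDataRow

open Literature.MathematicalPhysics.QuantumFieldTheory.Balaban1983to89
open B9Eq39Adjoint (R R_sub covD divB)
open B9Eq310Hermitian (norm_R_le)
open B9TorusCalculus (torusT torusT_apply)
open Summit.QuantumFields.YangMills.Theorems.Prop7ConjFrameTransition (R_frame_transition norm_transition_step_sub_le norm_frame_mismatch_le)
open Summit.QuantumFields.YangMills.Theorems.Prop7TentInterpolation (val_embIter)
open Summit.QuantumFields.YangMills.Theorems.Prop7HermiteLineCovariant (iterate_shift_update)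
open B5Eq118OneStroke (iterBlockOf val_iterBlockOf)
open B15DeterminingSets (embIter)

/-! ## §1 Abstract carrier: localised transition chain and the pair reduction -/

section Abstract

variable {𝔸 : Type} [NormedRing 𝔸] {S : Type*} {ι : Type*} (T : ι → Equiv.Perm S) (U : ι → S → 𝔸ˣ)

/-- ★ **LOCALISED TRANSITION CHAIN ALONG A RUN**: `‖g(x + t e_μ) − g(x)‖ ≤ t·τ` for `g = P⁻¹P′`, given the two holonomy size rows `‖h_μ − 1‖ + ‖h′_μ − 1‖ ≤ τ` only at the
run points `x + s e_μ`, `s < t`. [cite: Balaban1985BackgroundPropagators, (3.35) p.396] -/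
theorem norm_transition_iterate_sub_le {P P' : S → 𝔸ˣ} (hP : ∀ z : S, ‖(P z : 𝔸)‖ ≤ 1 ∧ ‖(((P z)⁻¹ : 𝔸ˣ) : 𝔸)‖ ≤ 1)
    (hP' : ∀ z : S, ‖(P' z : 𝔸)‖ ≤ 1 ∧ ‖(((P' z)⁻¹ : 𝔸ˣ) : 𝔸)‖ ≤ 1)
    (hU : ∀ (κ : ι) (z : S), ‖(U κ z : 𝔸)‖ ≤ 1 ∧ ‖(((U κ z)⁻¹ : 𝔸ˣ) : 𝔸)‖ ≤ 1) (μ : ι) (τ : ℝ) :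
    ∀ (t : ℕ) (x : S), (∀ s : ℕ, s < t →
      ‖(((P ((fun w => T μ w)^[s] x))⁻¹ * U μ ((fun w => T μ w)^[s] x) * P (T μ ((fun w => T μ w)^[s] x)) : 𝔸ˣ) : 𝔸) - 1‖
        + ‖(((P' ((fun w => T μ w)^[s] x))⁻¹ * U μ ((fun w => T μ w)^[s] x) * P' (T μ ((fun w => T μ w)^[s] x)) : 𝔸ˣ) : 𝔸) - 1‖ ≤ τ) →
      ‖(((P ((fun w => T μ w)^[t] x))⁻¹ * P' ((fun w => T μ w)^[t] x) : 𝔸ˣ) : 𝔸) - (((P x)⁻¹ * P' x : 𝔸ˣ) : 𝔸)‖ ≤ (t : ℝ) * τ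
  | 0, x, _ => by simp
  | t + 1, x, hrow => by
    have h0 := hrow 0 (Nat.succ_pos t)
    simp only [Function.iterate_zero, id] at h0
    have hrow' : ∀ s : ℕ, s < t →
        ‖(((P ((fun w => T μ w)^[s] (T μ x)))⁻¹ * U μ ((fun w => T μ w)^[s] (T μ x)) * P (T μ ((fun w => T μ w)^[s] (T μ x))) : 𝔸ˣ) : 𝔸) - 1‖
          + ‖(((P' ((fun w => T μ w)^[s] (T μ x)))⁻¹ * U μ ((fun w => T μ w)^[s] (T μ x)) * P' (T μ ((fun w => T μ w)^[s] (T μ x))) : 𝔸ˣ) : 𝔸) - 1‖ ≤ τ := by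
      intro s hs
      have e : (fun w => T μ w)^[s] (T μ x) = (fun w => T μ w)^[s + 1] x := (Function.iterate_succ_apply (fun w => T μ w) s x).symm
      rw [e]
      exact hrow (s + 1) (by omega)
    have ih := norm_transition_iterate_sub_le hP hP' hU μ τ t (T μ x) hrow'
    rw [Function.iterate_succ_apply]
    calc ‖(((P ((fun w => T μ w)^[t] (T μ x)))⁻¹ * P' ((fun w => T μ w)^[t] (T μ x)) : 𝔸ˣ) : 𝔸) - (((P x)⁻¹ * P' x : 𝔸ˣ) : 𝔸)‖
        ≤ ‖(((P ((fun w => T μ w)^[t] (T μ x)))⁻¹ * P' ((fun w => T μ w)^[t] (T μ x)) : 𝔸ˣ) : 𝔸) - (((P (T μ x))⁻¹ * P' (T μ x) : 𝔸ˣ) : 𝔸)‖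
          + ‖(((P (T μ x))⁻¹ * P' (T μ x) : 𝔸ˣ) : 𝔸) - (((P x)⁻¹ * P' x : 𝔸ˣ) : 𝔸)‖ := norm_sub_le_norm_sub_add_norm_sub _ _ _
      _ ≤ (t : ℝ) * τ + τ := add_le_add ih ((norm_transition_step_sub_le T U hP hP' hU μ x).trans h0)
      _ = ((t + 1 : ℕ) : ℝ) * τ := by push_cast; ring

omit T U in
/-- ★ **PAIR REDUCTION**: `‖R(F z)m − R(F₀ z)m₀‖ ≤ ‖R(F c₀)m − m₀‖ + 2‖g(z) − g(c₀)‖·‖m − c‖` for bi-contractive frames with `F₀ c₀ = 1`, `g = F₀⁻¹F`, `c` central.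
[cite: Balaban1985BackgroundPropagators, (3.3) p.390] -/
theorem dataRow_of_pair {F F₀ : S → 𝔸ˣ} (hF : ∀ z : S, ‖(F z : 𝔸)‖ ≤ 1 ∧ ‖(((F z)⁻¹ : 𝔸ˣ) : 𝔸)‖ ≤ 1)
    (hF₀ : ∀ z : S, ‖(F₀ z : 𝔸)‖ ≤ 1 ∧ ‖(((F₀ z)⁻¹ : 𝔸ˣ) : 𝔸)‖ ≤ 1) (c₀ : S) (h1 : F₀ c₀ = 1) (m m₀ c : 𝔸) (hc : ∀ a : 𝔸, Commute c a) (z : S) :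
    ‖R (F z) m - R (F₀ z) m₀‖
      ≤ ‖R (F c₀) m - m₀‖ + 2 * ‖(((F₀ z)⁻¹ * F z : 𝔸ˣ) : 𝔸) - (((F₀ c₀)⁻¹ * F c₀ : 𝔸ˣ) : 𝔸)‖ * ‖m - c‖ := by
  have hg0 : (F₀ c₀)⁻¹ * F c₀ = F c₀ := by rw [h1, inv_one, one_mul]
  have e : R (F z) m - R (F₀ z) m₀
      = (R (F₀ z) (R ((F₀ z)⁻¹ * F z) m) - R (F₀ z) (R ((F₀ c₀)⁻¹ * F c₀) m)) + R (F₀ z) (R (F c₀) m - m₀) := by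
    rw [R_frame_transition, hg0, R_sub]; abel
  rw [e]
  refine (norm_add_le _ _).trans ?_
  rw [add_comm]
  refine add_le_add (norm_R_le (hF₀ z).1 (hF₀ z).2 _) ?_
  exact norm_frame_mismatch_le hF₀ hF m c hc z c₀

end Abstract

/-! ## §2 The in-block coordinate path on the fine torus (offset `h = (ℓ−1)∕2`) -/

section Path

variable {P : Params} {k : ℕ} (hk : k ≤ P.m + P.K)

include hk

/-- a site whose coordinates are `embIter y₀ + s` with `0 ≤ s_ν < ℓ` has block label `y₀`. [cite: Balaban1984PropagatorsI, (1.18) p.20] -/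
theorem blockLabel_eq_of_coord (y₀ : Site P k) (w : Site P 0) (s : Fin P.d → ℕ) (hs : ∀ ν, s ν < P.L ^ k)
    (hw : ∀ ν, w ν = (embIter k y₀) ν + ((s ν : ℕ) : ZMod (P.sitesPerDir 0))) : (iterBlockOf k (fun κ => w κ - ((((P.L ^ k - 1) / 2 : ℕ)) : ZMod (P.sitesPerDir 0)))) = y₀ := by
  have hN : P.sitesPerDir 0 = P.sitesPerDir k * P.L ^ k := by
    unfold Params.sitesPerDir; rw [Nat.sub_zero, mul_assoc, ← pow_add, Nat.sub_add_cancel hk]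
  funext ν
  apply ZMod.val_injective
  rw [val_iterBlockOf k hk]
  have e : w ν - ((((P.L ^ k - 1) / 2 : ℕ)) : ZMod (P.sitesPerDir 0)) = ((((y₀ ν).val * P.L ^ k + s ν : ℕ)) : ZMod (P.sitesPerDir 0)) := by
    rw [hw ν, ← ZMod.natCast_zmod_val ((embIter k y₀) ν), val_embIter hk y₀ ν]; push_cast; ring
  have hlt : (y₀ ν).val * P.L ^ k + s ν < P.sitesPerDir 0 := by
    have hy : (y₀ ν).val + 1 ≤ P.sitesPerDir k := ZMod.val_lt (y₀ ν)
    have := Nat.mul_le_mul_right (P.L ^ k) hy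
    rw [hN]; rw [Nat.add_mul, one_mul] at this; have := hs ν; omega
  simp only [e, ZMod.val_natCast, Nat.mod_eq_of_lt hlt]
  rw [Nat.mul_comm, Nat.mul_add_div (pow_pos P.L_pos k), Nat.div_eq_of_lt (hs ν), add_zero]

/-- every site is its block centre plus its offsets: `z_ν = embIter(Q z)_ν + r_ν(z)`. [cite: Balaban1984PropagatorsI, (1.18) p.20] -/
theorem self_eq_centre_add_offset (z : Site P 0) (ν : Fin P.d) :
    z ν = (embIter k (iterBlockOf k (fun κ => z κ - ((((P.L ^ k - 1) / 2 : ℕ)) : ZMod (P.sitesPerDir 0))))) ν + ((((z ν - ((((P.L ^ k - 1) / 2 : ℕ)) : ZMod (P.sitesPerDir 0))).val % P.L ^ k : ℕ)) : ZMod (P.sitesPerDir 0)) := by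
  rw [← ZMod.natCast_zmod_val ((embIter k (iterBlockOf k (fun κ => z κ - ((((P.L ^ k - 1) / 2 : ℕ)) : ZMod (P.sitesPerDir 0))))) ν), val_embIter hk _ ν, val_iterBlockOf k hk]
  have e : z ν = (z ν - ((((P.L ^ k - 1) / 2 : ℕ)) : ZMod (P.sitesPerDir 0))) + ((((P.L ^ k - 1) / 2 : ℕ)) : ZMod (P.sitesPerDir 0)) := by ring
  conv_lhs => rw [e, ← ZMod.natCast_zmod_val (z ν - ((((P.L ^ k - 1) / 2 : ℕ)) : ZMod (P.sitesPerDir 0))), ← Nat.div_add_mod' ((z ν - ((((P.L ^ k - 1) / 2 : ℕ)) : ZMod (P.sitesPerDir 0))).val) (P.L ^ k)]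
  push_cast; ring

/-- the coordinate path: after `j` coordinates have been walked the point is `z` in the coordinates `< j` and the centre `embIter(Q z)` in the others; one more coordinate is a
run of `r_j(z)` unit steps. [cite: Balaban1984PropagatorsI, (1.18) p.20] -/
theorem path_succ (z : Site P 0) (j : ℕ) (hj : j < P.d) :
    (fun ν : Fin P.d => if (ν : ℕ) < j + 1 then z ν else (embIter k (iterBlockOf k (fun κ => z κ - ((((P.L ^ k - 1) / 2 : ℕ)) : ZMod (P.sitesPerDir 0))))) ν)
      = (fun w : Site P 0 => w.shift ⟨j, hj⟩)^[(z ⟨j, hj⟩ - ((((P.L ^ k - 1) / 2 : ℕ)) : ZMod (P.sitesPerDir 0))).val % P.L ^ k]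
          (fun ν : Fin P.d => if (ν : ℕ) < j then z ν else (embIter k (iterBlockOf k (fun κ => z κ - ((((P.L ^ k - 1) / 2 : ℕ)) : ZMod (P.sitesPerDir 0))))) ν) := by
  have e0 : (fun ν : Fin P.d => if (ν : ℕ) < j then z ν else (embIter k (iterBlockOf k (fun κ => z κ - ((((P.L ^ k - 1) / 2 : ℕ)) : ZMod (P.sitesPerDir 0))))) ν)
      = Function.update (fun ν : Fin P.d => if (ν : ℕ) < j then z ν else (embIter k (iterBlockOf k (fun κ => z κ - ((((P.L ^ k - 1) / 2 : ℕ)) : ZMod (P.sitesPerDir 0))))) ν) ⟨j, hj⟩ ((embIter k (iterBlockOf k (fun κ => z κ - ((((P.L ^ k - 1) / 2 : ℕ)) : ZMod (P.sitesPerDir 0))))) ⟨j, hj⟩) := by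
    rw [eq_comm, Function.update_eq_self_iff]; simp
  rw [e0, iterate_shift_update, ← self_eq_centre_add_offset hk z ⟨j, hj⟩]
  funext ν
  by_cases hν : ν = ⟨j, hj⟩
  · subst hν; simp
  · rw [Function.update_of_ne hν]
    have hνj : (ν : ℕ) ≠ j := fun e => hν (Fin.ext e)
    by_cases hlt : (ν : ℕ) < j
    · simp [hlt, show (ν : ℕ) < j + 1 by omega]
    · simp [hlt, show ¬ (ν : ℕ) < j + 1 by omega]

end Path

/-! ## §3 The data row at the lower-corner recentring -/

section Row

variable {𝔸 : Type} [NormedRing 𝔸] {P : Params} {k : ℕ} (hk : k ≤ P.m + P.K)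

include hk

/-- ★★ **THE TRANSITION FUNCTION ALONG THE IN-BLOCK PATH**: for two bi-contractive frames `F, F₀` whose holonomy size rows (`≤ a, ≤ a₀`) hold at every site of block
label `y₀ = Q z`, after `j ≤ d` coordinates `‖g(path_j) − g(embIter y₀)‖ ≤ j·ℓ·(a + a₀)`. [cite: Balaban1985BackgroundPropagators, (3.35) p.396] -/
theorem norm_transition_path_sub_le (U : Fin P.d → Site P 0 → 𝔸ˣ)
    (hU : ∀ (κ : Fin P.d) (z : Site P 0), ‖(U κ z : 𝔸)‖ ≤ 1 ∧ ‖(((U κ z)⁻¹ : 𝔸ˣ) : 𝔸)‖ ≤ 1)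
    {F F₀ : Site P 0 → 𝔸ˣ} (hF : ∀ z, ‖(F z : 𝔸)‖ ≤ 1 ∧ ‖(((F z)⁻¹ : 𝔸ˣ) : 𝔸)‖ ≤ 1) (hF₀ : ∀ z, ‖(F₀ z : 𝔸)‖ ≤ 1 ∧ ‖(((F₀ z)⁻¹ : 𝔸ˣ) : 𝔸)‖ ≤ 1)
    (z : Site P 0) {a a₀ : ℝ} (ha : 0 ≤ a) (ha₀ : 0 ≤ a₀)
    (hrow : ∀ w : Site P 0, (iterBlockOf k (fun κ => w κ - ((((P.L ^ k - 1) / 2 : ℕ)) : ZMod (P.sitesPerDir 0)))) = (iterBlockOf k (fun κ => z κ - ((((P.L ^ k - 1) / 2 : ℕ)) : ZMod (P.sitesPerDir 0)))) → ∀ μ : Fin P.d,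
      ‖(((F w)⁻¹ * U μ w * F (torusT P 0 μ w) : 𝔸ˣ) : 𝔸) - 1‖ ≤ a ∧ ‖(((F₀ w)⁻¹ * U μ w * F₀ (torusT P 0 μ w) : 𝔸ˣ) : 𝔸) - 1‖ ≤ a₀) :
    ∀ j : ℕ, j ≤ P.d →
      ‖(((F₀ (fun ν : Fin P.d => if (ν : ℕ) < j then z ν else (embIter k (iterBlockOf k (fun κ => z κ - ((((P.L ^ k - 1) / 2 : ℕ)) : ZMod (P.sitesPerDir 0))))) ν))⁻¹
            * F (fun ν : Fin P.d => if (ν : ℕ) < j then z ν else (embIter k (iterBlockOf k (fun κ => z κ - ((((P.L ^ k - 1) / 2 : ℕ)) : ZMod (P.sitesPerDir 0))))) ν) : 𝔸ˣ) : 𝔸)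
          - (((F₀ (embIter k (iterBlockOf k (fun κ => z κ - ((((P.L ^ k - 1) / 2 : ℕ)) : ZMod (P.sitesPerDir 0))))))⁻¹ * F (embIter k (iterBlockOf k (fun κ => z κ - ((((P.L ^ k - 1) / 2 : ℕ)) : ZMod (P.sitesPerDir 0))))) : 𝔸ˣ) : 𝔸)‖ ≤ (j : ℝ) * ((((P.L ^ k : ℕ) : ℝ)) * (a + a₀))
  | 0, _ => by simp
  | j + 1, hj => by
    have hj' : j < P.d := hj
    have ih := norm_transition_path_sub_le U hU hF hF₀ z ha ha₀ hrow j hj'.le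
    have hℓ : 0 < P.L ^ k := pow_pos P.L_pos k
    -- the run in coordinate `j`
    have hrun := norm_transition_iterate_sub_le (torusT P 0) U hF₀ hF hU ⟨j, hj'⟩ (a₀ + a) ((z ⟨j, hj'⟩ - ((((P.L ^ k - 1) / 2 : ℕ)) : ZMod (P.sitesPerDir 0))).val % P.L ^ k)
      (fun ν : Fin P.d => if (ν : ℕ) < j then z ν else (embIter k (iterBlockOf k (fun κ => z κ - ((((P.L ^ k - 1) / 2 : ℕ)) : ZMod (P.sitesPerDir 0))))) ν) (by
        intro s hs
        -- the run point has block label `Q z`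
        have hpt : (fun w => torusT P 0 ⟨j, hj'⟩ w)^[s] (fun ν : Fin P.d => if (ν : ℕ) < j then z ν else (embIter k (iterBlockOf k (fun κ => z κ - ((((P.L ^ k - 1) / 2 : ℕ)) : ZMod (P.sitesPerDir 0))))) ν)
            = Function.update (fun ν : Fin P.d => if (ν : ℕ) < j then z ν else (embIter k (iterBlockOf k (fun κ => z κ - ((((P.L ^ k - 1) / 2 : ℕ)) : ZMod (P.sitesPerDir 0))))) ν) ⟨j, hj'⟩ ((embIter k (iterBlockOf k (fun κ => z κ - ((((P.L ^ k - 1) / 2 : ℕ)) : ZMod (P.sitesPerDir 0))))) ⟨j, hj'⟩ + (s : ℕ)) := by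
          have e0 : (fun ν : Fin P.d => if (ν : ℕ) < j then z ν else (embIter k (iterBlockOf k (fun κ => z κ - ((((P.L ^ k - 1) / 2 : ℕ)) : ZMod (P.sitesPerDir 0))))) ν)
              = Function.update (fun ν : Fin P.d => if (ν : ℕ) < j then z ν else (embIter k (iterBlockOf k (fun κ => z κ - ((((P.L ^ k - 1) / 2 : ℕ)) : ZMod (P.sitesPerDir 0))))) ν) ⟨j, hj'⟩ ((embIter k (iterBlockOf k (fun κ => z κ - ((((P.L ^ k - 1) / 2 : ℕ)) : ZMod (P.sitesPerDir 0))))) ⟨j, hj'⟩) := by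
            rw [eq_comm, Function.update_eq_self_iff]; simp
          simp only [torusT_apply]
          conv_lhs => rw [e0]
          rw [iterate_shift_update]
        have hQ : iterBlockOf k (fun κ => ((fun w => torusT P 0 ⟨j, hj'⟩ w)^[s] (fun ν : Fin P.d => if (ν : ℕ) < j then z ν else (embIter k (iterBlockOf k (fun κ => z κ - ((((P.L ^ k - 1) / 2 : ℕ)) : ZMod (P.sitesPerDir 0))))) ν)) κ - ((((P.L ^ k - 1) / 2 : ℕ)) : ZMod (P.sitesPerDir 0))) = (iterBlockOf k (fun κ => z κ - ((((P.L ^ k - 1) / 2 : ℕ)) : ZMod (P.sitesPerDir 0)))) := by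
          rw [hpt]
          refine blockLabel_eq_of_coord hk (iterBlockOf k (fun κ => z κ - ((((P.L ^ k - 1) / 2 : ℕ)) : ZMod (P.sitesPerDir 0)))) _ (fun ν => if ν = ⟨j, hj'⟩ then s else if (ν : ℕ) < j then (z ν - ((((P.L ^ k - 1) / 2 : ℕ)) : ZMod (P.sitesPerDir 0))).val % P.L ^ k else 0)
            (fun ν => ?_) (fun ν => ?_)
          · by_cases h1 : ν = ⟨j, hj'⟩
            · simp only [h1, if_true]; exact hs.trans (Nat.mod_lt _ hℓ)
            · simp only [h1, if_false]; split_ifs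
              · exact Nat.mod_lt _ hℓ
              · exact hℓ
          · by_cases h1 : ν = ⟨j, hj'⟩
            · subst h1; simp
            · rw [Function.update_of_ne h1]; simp only [h1, if_false]
              by_cases h2 : (ν : ℕ) < j
              · simp only [h2, if_true]; exact self_eq_centre_add_offset hk z ν
              · simp [h2]
        obtain ⟨r1, r2⟩ := hrow _ hQ ⟨j, hj'⟩
        linarith)
    rw [path_succ hk z j hj']
    have hr : ((((z ⟨j, hj'⟩ - ((((P.L ^ k - 1) / 2 : ℕ)) : ZMod (P.sitesPerDir 0))).val % P.L ^ k : ℕ)) : ℝ) ≤ (((P.L ^ k : ℕ) : ℝ)) := by exact_mod_cast (Nat.mod_lt _ hℓ).le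
    have et : (fun w : Site P 0 => w.shift ⟨j, hj'⟩) = (fun w => torusT P 0 ⟨j, hj'⟩ w) := by funext w; rw [torusT_apply]
    rw [et]
    calc _ ≤ ‖(((F₀ ((fun w => torusT P 0 ⟨j, hj'⟩ w)^[(z ⟨j, hj'⟩ - ((((P.L ^ k - 1) / 2 : ℕ)) : ZMod (P.sitesPerDir 0))).val % P.L ^ k] (fun ν : Fin P.d => if (ν : ℕ) < j then z ν else (embIter k (iterBlockOf k (fun κ => z κ - ((((P.L ^ k - 1) / 2 : ℕ)) : ZMod (P.sitesPerDir 0))))) ν)))⁻¹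
              * F ((fun w => torusT P 0 ⟨j, hj'⟩ w)^[(z ⟨j, hj'⟩ - ((((P.L ^ k - 1) / 2 : ℕ)) : ZMod (P.sitesPerDir 0))).val % P.L ^ k] (fun ν : Fin P.d => if (ν : ℕ) < j then z ν else (embIter k (iterBlockOf k (fun κ => z κ - ((((P.L ^ k - 1) / 2 : ℕ)) : ZMod (P.sitesPerDir 0))))) ν)) : 𝔸ˣ) : 𝔸)
            - (((F₀ (fun ν : Fin P.d => if (ν : ℕ) < j then z ν else (embIter k (iterBlockOf k (fun κ => z κ - ((((P.L ^ k - 1) / 2 : ℕ)) : ZMod (P.sitesPerDir 0))))) ν))⁻¹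
              * F (fun ν : Fin P.d => if (ν : ℕ) < j then z ν else (embIter k (iterBlockOf k (fun κ => z κ - ((((P.L ^ k - 1) / 2 : ℕ)) : ZMod (P.sitesPerDir 0))))) ν) : 𝔸ˣ) : 𝔸)‖
          + ‖(((F₀ (fun ν : Fin P.d => if (ν : ℕ) < j then z ν else (embIter k (iterBlockOf k (fun κ => z κ - ((((P.L ^ k - 1) / 2 : ℕ)) : ZMod (P.sitesPerDir 0))))) ν))⁻¹
              * F (fun ν : Fin P.d => if (ν : ℕ) < j then z ν else (embIter k (iterBlockOf k (fun κ => z κ - ((((P.L ^ k - 1) / 2 : ℕ)) : ZMod (P.sitesPerDir 0))))) ν) : 𝔸ˣ) : 𝔸)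
            - (((F₀ (embIter k (iterBlockOf k (fun κ => z κ - ((((P.L ^ k - 1) / 2 : ℕ)) : ZMod (P.sitesPerDir 0))))))⁻¹ * F (embIter k (iterBlockOf k (fun κ => z κ - ((((P.L ^ k - 1) / 2 : ℕ)) : ZMod (P.sitesPerDir 0))))) : 𝔸ˣ) : 𝔸)‖ := norm_sub_le_norm_sub_add_norm_sub _ _ _
      _ ≤ ((((z ⟨j, hj'⟩ - ((((P.L ^ k - 1) / 2 : ℕ)) : ZMod (P.sitesPerDir 0))).val % P.L ^ k : ℕ)) : ℝ) * (a₀ + a) + (j : ℝ) * ((((P.L ^ k : ℕ) : ℝ)) * (a + a₀)) := add_le_add hrun ih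
      _ ≤ (((P.L ^ k : ℕ) : ℝ)) * (a₀ + a) + (j : ℝ) * ((((P.L ^ k : ℕ) : ℝ)) * (a + a₀)) := by
          have : 0 ≤ a₀ + a := add_nonneg ha₀ ha
          nlinarith
      _ = ((j + 1 : ℕ) : ℝ) * ((((P.L ^ k : ℕ) : ℝ)) * (a + a₀)) := by push_cast; ring

/-- ★★★ **THE DATA ROW AT THE LOWER-CORNER RECENTRING**: with bi-contractive frames normalised at their centres whose holonomy size row `a₀` holds on the support predicate,
central `c_y`, and the displayed PAIR ROW `‖R(Fr_y(embIter y₀)) m_y − m_(y₀)‖ ≤ D_y` for `y − y₀ ∈ {−1,0,1,2}^d`: on the support predicate,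
`‖R(Fr_y z) m_y − R(Fr_(Q z) z) m_(Q z)‖ ≤ D_y + 2·(d·ℓ·(a₀ + a₀))·‖m_y − c_y‖`. [cite: Balaban1985BackgroundPropagators, (3.3) p.390, (3.35) p.396] -/
theorem dataRow_lowerCorner (U : Fin P.d → Site P 0 → 𝔸ˣ)
    (hU : ∀ (κ : Fin P.d) (z : Site P 0), ‖(U κ z : 𝔸)‖ ≤ 1 ∧ ‖(((U κ z)⁻¹ : 𝔸ˣ) : 𝔸)‖ ≤ 1)
    (Fr : Site P k → Site P 0 → 𝔸ˣ) (hFr : ∀ y z, ‖(Fr y z : 𝔸)‖ ≤ 1 ∧ ‖(((Fr y z)⁻¹ : 𝔸ˣ) : 𝔸)‖ ≤ 1) (hFr1 : ∀ y, Fr y (embIter k y) = 1)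
    (m c : Site P k → 𝔸) (hc : ∀ y (a : 𝔸), Commute (c y) a) {a₀ : ℝ} (ha₀ : 0 ≤ a₀)
    (hA0 : ∀ (y : Site P k) (w : Site P 0), (∀ ν : Fin P.d, (y ν = (iterBlockOf k (fun κ => w κ - ((((P.L ^ k - 1) / 2 : ℕ)) : ZMod (P.sitesPerDir 0)))) ν - 1 ∨ y ν = (iterBlockOf k (fun κ => w κ - ((((P.L ^ k - 1) / 2 : ℕ)) : ZMod (P.sitesPerDir 0)))) ν ∨ y ν = (iterBlockOf k (fun κ => w κ - ((((P.L ^ k - 1) / 2 : ℕ)) : ZMod (P.sitesPerDir 0)))) ν + 1 ∨ y ν = (iterBlockOf k (fun κ => w κ - ((((P.L ^ k - 1) / 2 : ℕ)) : ZMod (P.sitesPerDir 0)))) ν + 2)) →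
      ∀ μ : Fin P.d, ‖(((Fr y w)⁻¹ * U μ w * Fr y (torusT P 0 μ w) : 𝔸ˣ) : 𝔸) - 1‖ ≤ a₀)
    (D : Site P k → ℝ)
    (hD : ∀ (y y₀ : Site P k), (∀ ν : Fin P.d, (y ν = y₀ ν - 1 ∨ y ν = y₀ ν ∨ y ν = y₀ ν + 1 ∨ y ν = y₀ ν + 2)) →
      ‖R (Fr y (embIter k y₀)) (m y) - m y₀‖ ≤ D y)
    (y : Site P k) (z : Site P 0) (hN : ∀ ν : Fin P.d, (y ν = (iterBlockOf k (fun κ => z κ - ((((P.L ^ k - 1) / 2 : ℕ)) : ZMod (P.sitesPerDir 0)))) ν - 1 ∨ y ν = (iterBlockOf k (fun κ => z κ - ((((P.L ^ k - 1) / 2 : ℕ)) : ZMod (P.sitesPerDir 0)))) ν ∨ y ν = (iterBlockOf k (fun κ => z κ - ((((P.L ^ k - 1) / 2 : ℕ)) : ZMod (P.sitesPerDir 0)))) ν + 1 ∨ y ν = (iterBlockOf k (fun κ => z κ - ((((P.L ^ k - 1) / 2 : ℕ)) : ZMod (P.sitesPerDir 0)))) ν + 2)) :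
    ‖R (Fr y z) (m y) - R (Fr (iterBlockOf k (fun κ => z κ - ((((P.L ^ k - 1) / 2 : ℕ)) : ZMod (P.sitesPerDir 0)))) z) (m (iterBlockOf k (fun κ => z κ - ((((P.L ^ k - 1) / 2 : ℕ)) : ZMod (P.sitesPerDir 0)))))‖ ≤ D y + 2 * ((P.d : ℝ) * ((((P.L ^ k : ℕ) : ℝ)) * (a₀ + a₀))) * ‖m y - c y‖ := by
  have hpair := dataRow_of_pair (hFr y) (hFr (iterBlockOf k (fun κ => z κ - ((((P.L ^ k - 1) / 2 : ℕ)) : ZMod (P.sitesPerDir 0))))) (embIter k (iterBlockOf k (fun κ => z κ - ((((P.L ^ k - 1) / 2 : ℕ)) : ZMod (P.sitesPerDir 0))))) (hFr1 _) (m y) (m (iterBlockOf k (fun κ => z κ - ((((P.L ^ k - 1) / 2 : ℕ)) : ZMod (P.sitesPerDir 0))))) (c y) (hc y) z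
  have hrow : ∀ w : Site P 0, (iterBlockOf k (fun κ => w κ - ((((P.L ^ k - 1) / 2 : ℕ)) : ZMod (P.sitesPerDir 0)))) = (iterBlockOf k (fun κ => z κ - ((((P.L ^ k - 1) / 2 : ℕ)) : ZMod (P.sitesPerDir 0)))) → ∀ μ : Fin P.d,
      ‖(((Fr y w)⁻¹ * U μ w * Fr y (torusT P 0 μ w) : 𝔸ˣ) : 𝔸) - 1‖ ≤ a₀
        ∧ ‖(((Fr (iterBlockOf k (fun κ => z κ - ((((P.L ^ k - 1) / 2 : ℕ)) : ZMod (P.sitesPerDir 0)))) w)⁻¹ * U μ w * Fr (iterBlockOf k (fun κ => z κ - ((((P.L ^ k - 1) / 2 : ℕ)) : ZMod (P.sitesPerDir 0)))) (torusT P 0 μ w) : 𝔸ˣ) : 𝔸) - 1‖ ≤ a₀ := by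
    intro w hw μ
    refine ⟨hA0 y w (fun ν => ?_) μ, hA0 (iterBlockOf k (fun κ => z κ - ((((P.L ^ k - 1) / 2 : ℕ)) : ZMod (P.sitesPerDir 0)))) w (fun ν => ?_) μ⟩
    · rw [hw]; exact hN ν
    · rw [hw]; exact Or.inr (Or.inl rfl)
  have hpath := norm_transition_path_sub_le hk U hU (hFr y) (hFr (iterBlockOf k (fun κ => z κ - ((((P.L ^ k - 1) / 2 : ℕ)) : ZMod (P.sitesPerDir 0))))) z ha₀ ha₀ hrow P.d le_rfl
  have hz : (fun ν : Fin P.d => if (ν : ℕ) < P.d then z ν else (embIter k (iterBlockOf k (fun κ => z κ - ((((P.L ^ k - 1) / 2 : ℕ)) : ZMod (P.sitesPerDir 0))))) ν) = z := by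
    funext ν; simp [ν.isLt]
  rw [hz] at hpath
  refine hpair.trans ((add_le_add (hD y (iterBlockOf k (fun κ => z κ - ((((P.L ^ k - 1) / 2 : ℕ)) : ZMod (P.sitesPerDir 0)))) hN) (mul_le_mul_of_nonneg_right (mul_le_mul_of_nonneg_left hpath (by norm_num)) (norm_nonneg _))).trans (le_of_eq ?_))
  ring

end Row

end Summit.QuantumFields.YangMills.Theorems.Prop7HermiteCornerDataRow

end
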